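import Literature.Analysis.FluidPDE.CompressibleEulerUniqueness
import HarnessLib

/-!
# Compressible Euler on `𝕋³`: continuation of classical solutions from a uniform restart time

Analysis/FluidPDE proof file (theorems only), part of the programme proving
`Literature.Analysis.FluidPDE.CompressibleEulerLocalWellPosedness` (Majda 1984, Thms 2.1–2.2;
Dafermos 2005, Thm 5.1.1). It isolates the *soft* half of the continuation principle
(Majda 1984, Thm 2.2 / Cor. 1, proof: "restart the local solution from `u(T - ε)`; by
uniqueness the two solutions agree on the overlap, so they define a classical solution on a
longer interval"): for the athermal pressure law `p = ρϑζ(ρ)`, `e = 3ϑ/2` (`ζ` smooth,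
`(ρζ)' > 0` on `(0, ρ̄)`), if a classical solution `(ρ, u, ϑ)` on `[0, T) × 𝕋³` with `ρ < ρ̄`
can be restarted from each of its time slices `(ρ, u, ϑ)(t₀)`, `0 ≤ t₀ < T`, with a common
life span `δ > 0` (and restarted density `< ρ̄`), then it extends to a classical solution on
`[0, T₂) × 𝕋³` for some `T₂ > T`, unchanged on `[0, T)` and with density `< ρ̄` throughout
(`IsClassicalEulerSolution.extend_of_uniform_restart`).

The *hard* half — that the a priori bounds of the continuation criterion yield such a uniform
restart time (the high-norm energy estimate plus the local existence theorem with life span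
controlled by the high norm) — is thereby separated from the bookkeeping, which uses only the
uniqueness theorem `IsClassicalEulerSolution.unique_monatomicExcess`
(`CompressibleEulerUniqueness.lean`) and the gluing lemma `IsClassicalEulerSolutionOn.glue`
(`CompressibleEulerClassicalGlue.lean`). `continuation_of_uniform_restart` records the resulting
reduction of clause (ii) of `CompressibleEulerLocalWellPosedness` verbatim.

## References

* A. Majda, *Compressible Fluid Flow and Systems of Conservation Laws in Several Space
  Variables*, Springer 1984, Ch. 2 §2.1, Thm 2.1 (uniqueness clause), Thm 2.2 and its proof
  (continuation by restarting). [`Majda1984`]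
* C. M. Dafermos, *Hyperbolic Conservation Laws in Continuum Physics*, 2nd ed., Springer 2005,
  Thm 5.1.1 and Remark, pp. 122–126. [`Dafermos2005`]
-/

noncomputable section

open Set Function Filter
open scoped ContDiff

namespace Literature.Analysis.FluidPDE

namespace CompressibleEuler

variable {T ρm : ℝ} {ρ : ℝ → UnitAddTorus (Fin 3) → ℝ}
  {u : ℝ → UnitAddTorus (Fin 3) → EuclideanSpace ℝ (Fin 3)} {ϑ : ℝ → UnitAddTorus (Fin 3) → ℝ}

/-- **Gluing a restart, keeping a density bound** (variant of
`IsClassicalEulerSolution.extend_of_restart` exposing the glued fields): a classical solution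
on `[0, T)` and a classical solution on `[t₀, t₀ + δ) ⊇ [t₀, T]` agreeing with it on `(t₀, T)`
define a classical solution on `[0, t₀ + δ)`, equal to the first on `[0, T)`; a strict upper
bound for the density valid for the first solution on `[0, T)` and for the second on
`[T, t₀ + δ)` persists. [cite: Majda1984, Ch. 2 §2.1, proof of Thm 2.2] -/
theorem IsClassicalEulerSolution.extend_of_restart_lt {eos : EulerEOS} {t₀ δ : ℝ}
    {ρ₂ ϑ₂ : ℝ → UnitAddTorus (Fin 3) → ℝ} {u₂ : ℝ → UnitAddTorus (Fin 3) → EuclideanSpace ℝ (Fin 3)}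
    (h₁ : IsClassicalEulerSolution eos T ρ u ϑ)
    (h₂ : IsClassicalEulerSolution eos δ (fun t => ρ₂ (t + t₀)) (fun t => u₂ (t + t₀))
      (fun t => ϑ₂ (t + t₀)))
    (ht₀ : 0 ≤ t₀) (ht₀T : t₀ < T) (hT : T ≤ t₀ + δ)
    (heq : ∀ t ∈ Ioo t₀ T, ρ t = ρ₂ t ∧ u t = u₂ t ∧ ϑ t = ϑ₂ t)
    (hb₁ : ∀ t ∈ Ico 0 T, ∀ x, ρ t x < ρm) (hb₂ : ∀ t ∈ Ico T (t₀ + δ), ∀ x, ρ₂ t x < ρm) :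
    ∃ (ρ' ϑ' : ℝ → UnitAddTorus (Fin 3) → ℝ) (u' : ℝ → UnitAddTorus (Fin 3) → EuclideanSpace ℝ (Fin 3)),
      IsClassicalEulerSolution eos (t₀ + δ) ρ' u' ϑ' ∧
        (∀ t ∈ Ico 0 T, ρ' t = ρ t ∧ u' t = u t ∧ ϑ' t = ϑ t) ∧
        ∀ t ∈ Ico 0 (t₀ + δ), ∀ x, ρ' t x < ρm := by
  refine ⟨_, _, _, isClassicalEulerSolutionOn_Ico_iff.1
    ((isClassicalEulerSolutionOn_Ico_iff.2 h₁).glue h₂.on_Ioo_of_translate ht₀ ht₀T hT heq),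
    fun t ht => ?_, fun t ht x => ?_⟩
  · simp only [if_pos ht.2, and_self]
  · by_cases htT : t < T
    · simp only [if_pos htT]
      exact hb₁ t ⟨ht.1, htT⟩ x
    · simp only [if_neg htT]
      exact hb₂ t ⟨not_lt.1 htT, ht.2⟩ x

variable {ζ f : ℝ → ℝ}

/-- **Continuation from a uniform restart time** (Majda 1984, proof of Thm 2.2: restart the
local solution shortly before `T` and glue by uniqueness). For the athermal law `p = ρϑζ(ρ)`,
`e = 3ϑ/2` with `ζ` smooth and `(ρζ)' > 0` on `(0, ρ̄)`: let `(ρ, u, ϑ)` be a classical solution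
on `[0, T) × 𝕋³`, `T > 0`, with `ρ < ρ̄`, and suppose there is `δ > 0` such that from every
slice `(ρ, u, ϑ)(t₀)`, `0 ≤ t₀ < T`, a classical solution with density `< ρ̄` starts and lives on
`[0, δ)`. Then `(ρ, u, ϑ)` extends to a classical solution on `[0, T₂) × 𝕋³` for some `T₂ > T`,
unchanged on `[0, T)` and with density `< ρ̄` on `[0, T₂)`. (Restart at
`t₀ = max 0 (T - δ/2)`; the restarted solution agrees with the time-translate of `(ρ, u, ϑ)` on
`[0, T - t₀)` by `IsClassicalEulerSolution.unique_monatomicExcess`; glue with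
`extend_of_restart_lt`; `T₂ = t₀ + δ ≥ T + δ/2`.) [cite: Majda1984, Ch. 2 §2.1 Thm 2.2] -/
theorem IsClassicalEulerSolution.extend_of_uniform_restart (hζ : ContDiff ℝ ∞ ζ)
    (hζ' : ∀ r ∈ Ioo 0 ρm, 0 < deriv (fun s : ℝ => s * ζ s) r) (hT : 0 < T)
    (h : IsClassicalEulerSolution (EulerEOS.monatomicExcess ζ f) T ρ u ϑ)
    (hρm : ∀ t ∈ Ico 0 T, ∀ x, ρ t x < ρm) {δ : ℝ} (hδ : 0 < δ)
    (hrestart : ∀ t₀ ∈ Ico 0 T, ∃ (ρ₂ ϑ₂ : ℝ → UnitAddTorus (Fin 3) → ℝ)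
      (u₂ : ℝ → UnitAddTorus (Fin 3) → EuclideanSpace ℝ (Fin 3)),
      IsClassicalEulerSolution (EulerEOS.monatomicExcess ζ f) δ ρ₂ u₂ ϑ₂ ∧
        ρ₂ 0 = ρ t₀ ∧ u₂ 0 = u t₀ ∧ ϑ₂ 0 = ϑ t₀ ∧ ∀ t ∈ Ico 0 δ, ∀ x, ρ₂ t x < ρm) :
    ∃ T₂ : ℝ, T < T₂ ∧ ∃ (ρ' ϑ' : ℝ → UnitAddTorus (Fin 3) → ℝ)
      (u' : ℝ → UnitAddTorus (Fin 3) → EuclideanSpace ℝ (Fin 3)),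
      IsClassicalEulerSolution (EulerEOS.monatomicExcess ζ f) T₂ ρ' u' ϑ' ∧
        (∀ t ∈ Ico 0 T, ρ' t = ρ t ∧ u' t = u t ∧ ϑ' t = ϑ t) ∧
        ∀ t ∈ Ico 0 T₂, ∀ x, ρ' t x < ρm := by
  set t₀ : ℝ := max 0 (T - δ / 2) with ht₀
  have ht₀0 : 0 ≤ t₀ := le_max_left _ _
  have ht₀T : t₀ < T := max_lt hT (by linarith)
  have hTt₀ : T - δ / 2 ≤ t₀ := le_max_right _ _
  obtain ⟨ρ₂, ϑ₂, u₂, h₂, h0ρ, h0u, h0ϑ, hρ₂m⟩ := hrestart t₀ ⟨ht₀0, ht₀T⟩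
  -- the restarted solution agrees with the translate of `(ρ, u, ϑ)` on `[0, T - t₀)`
  have he : ContDiffOn ℝ ∞ (uncurry (EulerEOS.monatomicExcess ζ f).e) (Ioi 0 ×ˢ Ioi 0) :=
    contDiff_monatomicExcess_e.contDiffOn
  have h₁ := h.translate_Ico he ht₀0
  have huniq := IsClassicalEulerSolution.unique_monatomicExcess hζ hζ' h₁ h₂
    (fun s hs x => hρm (s + t₀) ⟨by linarith [hs.1], by linarith [hs.2]⟩ x)
    (by funext x; show ρ (0 + t₀) x = ρ₂ 0 x; rw [zero_add, h0ρ])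
    (by funext x; show u (0 + t₀) x = u₂ 0 x; rw [zero_add, h0u])
    (by funext x; show ϑ (0 + t₀) x = ϑ₂ 0 x; rw [zero_add, h0ϑ])
  -- the restart in absolute time
  set ρ₃ : ℝ → UnitAddTorus (Fin 3) → ℝ := fun t => ρ₂ (t - t₀) with hρ₃
  set u₃ : ℝ → UnitAddTorus (Fin 3) → EuclideanSpace ℝ (Fin 3) := fun t => u₂ (t - t₀) with hu₃
  set ϑ₃ : ℝ → UnitAddTorus (Fin 3) → ℝ := fun t => ϑ₂ (t - t₀) with hϑ₃
  have h₃ : IsClassicalEulerSolution (EulerEOS.monatomicExcess ζ f) δ (fun t => ρ₃ (t + t₀))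
      (fun t => u₃ (t + t₀)) (fun t => ϑ₃ (t + t₀)) := by
    simpa only [hρ₃, hu₃, hϑ₃, add_sub_cancel_right] using h₂
  have heq : ∀ t ∈ Ioo t₀ T, ρ t = ρ₃ t ∧ u t = u₃ t ∧ ϑ t = ϑ₃ t := by
    intro t ht
    have hs : t - t₀ ∈ Ico 0 (min (T - t₀) δ) :=
      ⟨by linarith [ht.1], lt_min (by linarith [ht.2]) (by linarith [ht.2])⟩
    have k := huniq (t - t₀) hs
    simp only [sub_add_cancel] at k
    exact k
  have hb₂ : ∀ t ∈ Ico T (t₀ + δ), ∀ x, ρ₃ t x < ρm := fun t ht x =>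
    hρ₂m (t - t₀) ⟨by linarith [ht.1], by linarith [ht.2]⟩ x
  obtain ⟨ρ', ϑ', u', h', heq', hb'⟩ :=
    h.extend_of_restart_lt h₃ ht₀0 ht₀T (by linarith) heq hρm hb₂
  exact ⟨t₀ + δ, by linarith, ρ', ϑ', u', h', heq', hb'⟩

/-- **Reduction of the continuation clause to a uniform restart time.** Clause (ii) of
`CompressibleEulerLocalWellPosedness` (continuation of a classical solution on `[0, T)` whose
density, temperature, velocity and first derivatives obey the stated uniform bounds) follows
as soon as those bounds yield a *uniform restart time*: some `δ > 0` such that from every slice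
`(ρ, u, ϑ)(t₀)`, `0 ≤ t₀ < T`, a classical solution with density `< ρ̄` lives on `[0, δ)` — which
is how Majda proves Thm 2.2 (a priori high-norm bound from the `C¹` bound, then the local
existence theorem with life span controlled by the high norm). [cite: Majda1984, Ch. 2 §2.1 Thm 2.2] -/
theorem continuation_of_uniform_restart (hζ : ContDiff ℝ ∞ ζ)
    (hζ' : ∀ r ∈ Ioo 0 ρm, 0 < deriv (fun s : ℝ => s * ζ s) r)
    (H : ∀ T : ℝ, 0 < T → ∀ (ρ ϑ : ℝ → UnitAddTorus (Fin 3) → ℝ)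
        (u : ℝ → UnitAddTorus (Fin 3) → EuclideanSpace ℝ (Fin 3)),
      IsClassicalEulerSolution (EulerEOS.monatomicExcess ζ f) T ρ u ϑ →
      (∃ M ρ₁ : ℝ, ρ₁ < ρm ∧ ∀ t ∈ Ico 0 T, ∀ x,
        M⁻¹ ≤ ρ t x ∧ ρ t x ≤ ρ₁ ∧ M⁻¹ ≤ ϑ t x ∧ ϑ t x ≤ M ∧ ‖u t x‖ ≤ M ∧
        ‖FunctionSpaces.Torus.fderiv (ρ t) x‖ ≤ M ∧ ‖FunctionSpaces.Torus.fderiv (u t) x‖ ≤ M ∧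
        ‖FunctionSpaces.Torus.fderiv (ϑ t) x‖ ≤ M) →
      ∃ δ : ℝ, 0 < δ ∧ ∀ t₀ ∈ Ico 0 T, ∃ (ρ₂ ϑ₂ : ℝ → UnitAddTorus (Fin 3) → ℝ)
        (u₂ : ℝ → UnitAddTorus (Fin 3) → EuclideanSpace ℝ (Fin 3)),
        IsClassicalEulerSolution (EulerEOS.monatomicExcess ζ f) δ ρ₂ u₂ ϑ₂ ∧
          ρ₂ 0 = ρ t₀ ∧ u₂ 0 = u t₀ ∧ ϑ₂ 0 = ϑ t₀ ∧ ∀ t ∈ Ico 0 δ, ∀ x, ρ₂ t x < ρm) :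
    ∀ T : ℝ, 0 < T → ∀ (ρ ϑ : ℝ → UnitAddTorus (Fin 3) → ℝ)
        (u : ℝ → UnitAddTorus (Fin 3) → EuclideanSpace ℝ (Fin 3)),
      IsClassicalEulerSolution (EulerEOS.monatomicExcess ζ f) T ρ u ϑ →
      (∃ M ρ₁ : ℝ, ρ₁ < ρm ∧ ∀ t ∈ Ico 0 T, ∀ x,
        M⁻¹ ≤ ρ t x ∧ ρ t x ≤ ρ₁ ∧ M⁻¹ ≤ ϑ t x ∧ ϑ t x ≤ M ∧ ‖u t x‖ ≤ M ∧
        ‖FunctionSpaces.Torus.fderiv (ρ t) x‖ ≤ M ∧ ‖FunctionSpaces.Torus.fderiv (u t) x‖ ≤ M ∧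
        ‖FunctionSpaces.Torus.fderiv (ϑ t) x‖ ≤ M) →
      ∃ T₂ : ℝ, T < T₂ ∧ ∃ (ρ' ϑ' : ℝ → UnitAddTorus (Fin 3) → ℝ)
        (u' : ℝ → UnitAddTorus (Fin 3) → EuclideanSpace ℝ (Fin 3)),
        IsClassicalEulerSolution (EulerEOS.monatomicExcess ζ f) T₂ ρ' u' ϑ' ∧
          (∀ t ∈ Ico 0 T, ρ' t = ρ t ∧ u' t = u t ∧ ϑ' t = ϑ t) ∧
          ∀ t ∈ Ico 0 T₂, ∀ x, ρ' t x < ρm := by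
  intro T hT ρ ϑ u h hb
  obtain ⟨δ, hδ, hrestart⟩ := H T hT ρ ϑ u h hb
  obtain ⟨M, ρ₁, hρ₁, hM⟩ := hb
  exact h.extend_of_uniform_restart hζ hζ' hT (fun t ht x => ((hM t ht x).2.1).trans_lt hρ₁) hδ
    hrestart

end CompressibleEuler

end Literature.Analysis.FluidPDE

end
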